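import Literature.NumberTheory.EllipticCurves.BigGaloisRepSelmer
import Literature.NumberTheory.IwasawaTheory.Greenberg2006.CofiniteGenerationCriterion
import Summits.BirchSwinnertonDyer.BirchSwinnertonDyer.Theorems.EisensteinPrimesBSDpOnCellCTelescopeK2BigRepTDivisible
import Summits.BirchSwinnertonDyer.BirchSwinnertonDyer.Theorems.ErratumRoadFiveBigRepLocalInputs
import HarnessLib

/-!
# Crux 4 `BSDpOnCellC` (stmt-BirchSwinnertonDyer-19034), line «telescope», node W4⁰ (`K2Weight2.stub_bigPseudoNullPTorsion`),
# route G′ — model facts (M2′) + (M1) at an inertia place: `𝐃^{I_w} = Maps_sm(ℤ_p, A^{I_w})` for `w ∤ p`, and the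
# almost-divisible core `p^a · L_w` for every `B`-quotient `L_w` of `𝐃^{I_w}`
# (ideator bsd-idea-12 g39; `--supports`, helper; closes nothing)

Context. Route G′ for W4⁰ (memo `Cruxes/BSDpOnCellC/W-PRICING-n2.md` rev 1.8 §W4-G′) replaces the local condition `L_w`
(`w ∈ Σ`, `w ∤ p`) of the Greenberg Selmer group of the big module `𝐃 = Maps_sm(ℤ_p, A) = BigRepModule 𝒪 p A` by the core
`p^{a_w} · L_w`, which must be ALMOST DIVISIBLE. Part 2 (p757620, `…TelescopeK2PurityCoreAtBadPrimes`) and helper #3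
(`…TelescopeK2BigRepTDivisible`) reduce this to: (M1) the character module of `M = 𝐃^{I_w}` is finitely generated over
`B = 𝒪⟦T⟧`, (M2′) `M` is cut out of `𝐃` by a VALUE condition, (M3) `L_w` is a `B`-quotient of `M`. This file proves (M2′) and
(M1) and leaves exactly (M3) as a hypothesis:

* §1 (any group `G`, any `κ : G → ℤ_p`, any `g` with `κ g = 1`): in the co-induced model `(g · Φ)(x) = ρ(g)(Φ(x − κ g))`
  (`bigRep_apply_apply`), an element `g ∈ ker κ` acts VALUE-WISE, so `Φ` is fixed by a family `φ : H → ker κ` iff all its values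
  are (`bigRep_eq_self_iff_of_map_eq_one`, `mem_invariants_bigRep_restrict_iff`, `mem_iInf_eqLocus_bigRep_iff`).
* §2 (the cell: `K` a number field, `κ : ZpExtension K p`, `w ∤ p`): `κ` kills the inertia group `I_w`
  (the tree's `Rank1Residual.X11b.BigRep.kappa_localMap_inr_eq_one`, p479748's sequel — ℤ_p-extensions are unramified
  outside `p`, Washington Prop. 13.2), hence **`𝐃^{I_w} = {Φ | ∀ x, Φ x ∈ A^{I_w}}`** in both tree spellings of invariants
  (`mem_invariants_restrict_inr_iff`, `mem_iInf_eqLocus_restrict_inr_iff`).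
* §3 docking (`𝒪 = ℤ_p⟦X⟧`, `B = IwasawaAlgebra₂ p`): from `hD : IsCofinitelyGenerated B 𝐃` (the W1 input, p750844/p752319)
  the character module of `𝐃^{I_w}` is finitely generated (Greenberg 2006 §3A: submodules), and with helper #3
  **`exists_isAlmostDivisible_map_lsmul_pow_of_inertia`**: for every `B`-linear SURJECTION `π : 𝐃^{I_w} ↠ L_w ≤ H`, SOME
  `p^a · L_w` is almost divisible — the per-place input (ii′) of route G′ at `w ∤ p`, modulo (M3) only.

HONESTY. Nothing here proves W4⁰, W4, N2, the crux `BSDpOnCellC` or any summit statement; (M3) (the unramified local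
condition `ker(H¹(K_w, 𝐃) → H¹(I_w, 𝐃))` is a `B`-quotient of `𝐃^{I_w}`), the Greenberg-side rows of G′ (Prop. 4.1.1 (c) for the
core specification) and the dictionary to `X₂` stay displayed, not claimed. BSD is proved for no curve. AI-typed, kernel-checked;
theorems only (no `def`, no instance, no named fact, no `sorry`).

[cite: Castella2018, §2.1 (𝒜 := T ⊗ Λ^*, G_K-action ρ ⊗ Ψ^{-1})] [cite: Washington1997, Prop. 13.2] [cite: Greenberg2006, §3 A (p. 358 L35–36)]
[cite: Greenberg2016Selmer, §2.5 p. 8 L35–37, Remark 3.1.2, §4.2 p. 19 L25–31]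
-/

set_option autoImplicit false
-- every decl lives in the file's own namespace; the linter fires on the path-vs-namespace mismatch only
set_option linter.dupNamespace false

open Field IsDedekindDomain NumberField
open Literature.NumberTheory.GaloisRepresentations Literature.NumberTheory.EllipticCurves
  Literature.NumberTheory.EllipticCurves.BigGaloisRep
open Literature.NumberTheory.IwasawaTheory Literature.NumberTheory.IwasawaTheory.Greenberg2016

namespace Summit.BirchSwinnertonDyer.BirchSwinnertonDyer.Theorems.TelescopeK2BigRepInertiaInvariants

universe u

/-! ## §1 Elements of `ker κ` act value-wise on `Maps_sm(ℤ_p, A)` -/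

section General

variable {𝒪 : Type*} [CommRing 𝒪] [TopologicalSpace 𝒪] {p : ℕ} [Fact p.Prime]
  {A : Type u} [AddCommGroup A] [Module 𝒪 A] [TopologicalSpace A] [DiscreteTopology A]
  {G : Type u} [Group G] [TopologicalSpace G] [ContinuousMul G] [TopologicalSpace (PowerSeries 𝒪)]

/-- For `κ g = 1` the action is value-wise: `(g · Φ)(x) = ρ(g)(Φ(x))`. [cite: Castella2018, §2.1 (G_K-action ρ ⊗ Ψ^{-1} on 𝒜)] -/
theorem bigRep_apply_of_map_eq_one (κ : G →ₜ* Multiplicative ℤ_[p]) (ρ : ContinuousRep G 𝒪 A) {g : G}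
    (hg : κ g = 1) (Φ : BigRepModule 𝒪 p A) (x : ℤ_[p]) : bigRep κ ρ g Φ x = ρ g (Φ x) := by
  rw [bigRep_apply_apply, hg, toAdd_one, sub_zero]

/-- For `κ g = 1`: `g · Φ = Φ` iff every value of `Φ` is fixed by `ρ(g)`. [cite: Castella2018, §2.1 (G_K-action ρ ⊗ Ψ^{-1} on 𝒜)] -/
theorem bigRep_eq_self_iff_of_map_eq_one (κ : G →ₜ* Multiplicative ℤ_[p]) (ρ : ContinuousRep G 𝒪 A) {g : G}
    (hg : κ g = 1) (Φ : BigRepModule 𝒪 p A) :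
    bigRep κ ρ g Φ = Φ ↔ ∀ x, ρ g (Φ x) = Φ x := by
  refine ⟨fun h x ↦ ?_, fun h ↦ BigRepModule.ext fun x ↦ ?_⟩
  · have hx := DFunLike.congr_fun h x
    rwa [bigRep_apply_of_map_eq_one κ ρ hg] at hx
  · rw [bigRep_apply_of_map_eq_one κ ρ hg, h]

/-- **Invariants under a family in `ker κ` are cut out by values** (`⨅ eqLocus` spelling, no topology on the action):
`Φ ∈ ⨅_h eqLocus(g_h) ↔ ∀ x, Φ x ∈ ⨅_h eqLocus(ρ g_h)`. [cite: Castella2018, §2.1 (G_K-action ρ ⊗ Ψ^{-1} on 𝒜)] -/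
theorem mem_iInf_eqLocus_bigRep_iff {H : Type*} (κ : G →ₜ* Multiplicative ℤ_[p]) (ρ : ContinuousRep G 𝒪 A)
    (φ : H → G) (hφ : ∀ h, κ (φ h) = 1) (Φ : BigRepModule 𝒪 p A) :
    Φ ∈ (⨅ h : H, LinearMap.eqLocus ((bigRep κ ρ (φ h) : BigRepModule 𝒪 p A →ₗ[PowerSeries 𝒪] BigRepModule 𝒪 p A))
        LinearMap.id) ↔
      ∀ x, Φ x ∈ ⨅ h : H, LinearMap.eqLocus (ρ (φ h)) LinearMap.id := by
  simp only [Submodule.mem_iInf, LinearMap.mem_eqLocus, LinearMap.id_apply]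
  exact ⟨fun hΦ x h ↦ (bigRep_eq_self_iff_of_map_eq_one κ ρ (hφ h) Φ).mp (hΦ h) x,
    fun hΦ h ↦ (bigRep_eq_self_iff_of_map_eq_one κ ρ (hφ h) Φ).mpr fun x ↦ hΦ x h⟩

variable [ContinuousSMul (PowerSeries 𝒪) (BigRepModule 𝒪 p A)]

/-- **Invariants of the restricted big representation are cut out by values** (`Representation.invariants` spelling
of the big side): for `φ : H →ₜ* G` with `κ ∘ φ = 1`, `Φ ∈ (𝐃|_H)^H ↔ ∀ x, Φ x ∈ ⨅_h eqLocus(ρ (φ h))`.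
[cite: Castella2018, §2.1 (G_K-action ρ ⊗ Ψ^{-1} on 𝒜)] -/
theorem mem_invariants_bigRep_restrict_iff {H : Type u} [Group H] [TopologicalSpace H]
    (κ : G →ₜ* Multiplicative ℤ_[p]) (ρ : ContinuousRep G 𝒪 A) (φ : H →ₜ* G) (hφ : ∀ h, κ (φ h) = 1)
    (Φ : BigRepModule 𝒪 p A) :
    Φ ∈ ((bigRep κ ρ).restrict φ).toTopRep.ρ.invariants ↔
      ∀ x, Φ x ∈ ⨅ h : H, LinearMap.eqLocus (ρ (φ h)) LinearMap.id := by
  simp only [Submodule.mem_iInf, LinearMap.mem_eqLocus, LinearMap.id_apply]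
  exact ⟨fun hΦ x h ↦ (bigRep_eq_self_iff_of_map_eq_one κ ρ (hφ h) Φ).mp (hΦ h) x,
    fun hΦ h ↦ (bigRep_eq_self_iff_of_map_eq_one κ ρ (hφ h) Φ).mpr fun x ↦ hΦ x h⟩

end General

/-! ## §2 The cell: `κ` a `ℤ_p`-extension of a number field, `w ∤ p` -/

section Cell

variable {K : Type} [Field K] [NumberField K] {p : ℕ} [Fact p.Prime]

variable {𝒪 : Type*} [CommRing 𝒪] [TopologicalSpace 𝒪] {A : Type} [AddCommGroup A] [Module 𝒪 A]
  [TopologicalSpace A] [DiscreteTopology A] [TopologicalSpace (PowerSeries 𝒪)]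

/-- **`𝐃^{I_w} = Maps_sm(ℤ_p, A^{I_w})` at `w ∤ p`** (`⨅ eqLocus` spelling on both sides).
[cite: Castella2018, §2.1 (G_K-action ρ ⊗ Ψ^{-1} on 𝒜)] [cite: Washington1997, Prop. 13.2] -/
theorem mem_iInf_eqLocus_restrict_inr_iff (κ : ZpExtension K p)
    (ρ : ContinuousRep (absoluteGaloisGroup K) 𝒪 A) {w : HeightOneSpectrum (𝓞 K)} (hw : ((p : ℕ) : 𝓞 K) ∉ w.asIdeal)
    (Φ : BigRepModule 𝒪 p A) :
    Φ ∈ (⨅ h : LocalGroup K (Sum.inr w),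
        LinearMap.eqLocus ((AnticyclotomicBigGaloisRep κ ρ (localMap K (Sum.inr w) h) :
          BigRepModule 𝒪 p A →ₗ[PowerSeries 𝒪] BigRepModule 𝒪 p A)) LinearMap.id) ↔
      ∀ x, Φ x ∈ ⨅ h : LocalGroup K (Sum.inr w), LinearMap.eqLocus (ρ (localMap K (Sum.inr w) h)) LinearMap.id :=
  mem_iInf_eqLocus_bigRep_iff κ.toContinuousMonoidHom ρ (fun h ↦ localMap K (Sum.inr w) h)
    (Rank1Residual.X11b.BigRep.kappa_localMap_inr_eq_one κ hw) Φ

variable [ContinuousSMul (PowerSeries 𝒪) (BigRepModule 𝒪 p A)]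

/-- **`𝐃^{I_w} = Maps_sm(ℤ_p, A^{I_w})` at `w ∤ p`** (`Representation.invariants` of the restricted big representation
`𝐃|_{I_w}`, the spelling of the Greenberg arena). [cite: Castella2018, §2.1 (G_K-action ρ ⊗ Ψ^{-1} on 𝒜)] [cite: Washington1997, Prop. 13.2] -/
theorem mem_invariants_restrict_inr_iff (κ : ZpExtension K p)
    (ρ : ContinuousRep (absoluteGaloisGroup K) 𝒪 A) {w : HeightOneSpectrum (𝓞 K)} (hw : ((p : ℕ) : 𝓞 K) ∉ w.asIdeal)
    (Φ : BigRepModule 𝒪 p A) :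
    Φ ∈ ((AnticyclotomicBigGaloisRep κ ρ).restrict (localMap K (Sum.inr w))).toTopRep.ρ.invariants ↔
      ∀ x, Φ x ∈ ⨅ h : LocalGroup K (Sum.inr w), LinearMap.eqLocus (ρ (localMap K (Sum.inr w) h)) LinearMap.id :=
  mem_invariants_bigRep_restrict_iff κ.toContinuousMonoidHom ρ (localMap K (Sum.inr w))
    (Rank1Residual.X11b.BigRep.kappa_localMap_inr_eq_one κ hw) Φ

end Cell

/-! ## §3 Docking: the almost-divisible core at an inertia place, modulo (M3) -/

section Docking

variable {K : Type} [Field K] [NumberField K] (p : ℕ) [Fact p.Prime]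
  {A : Type} [AddCommGroup A] [Module (IwasawaAlgebra p) A] [TopologicalSpace A] [DiscreteTopology A]
  [TopologicalSpace (IwasawaAlgebra p)] [TopologicalSpace (IwasawaAlgebra₂ p)]
  [ContinuousSMul (IwasawaAlgebra₂ p) (BigRepModule (IwasawaAlgebra p) p A)]

/-- **(M1): the character module of `𝐃^{I_w}` is finitely generated over `B`**, from the W1 input
`IsCofinitelyGenerated B 𝐃` (a submodule of a cofinitely generated module is cofinitely generated). [cite: Greenberg2006, §3 A (p. 358 L35–36)] -/
theorem module_finite_characterModule_invariants_restrict (κ : ZpExtension K p)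
    (ρ : ContinuousRep (absoluteGaloisGroup K) (IwasawaAlgebra p) A)
    (hD : Greenberg2006.IsCofinitelyGenerated (IwasawaAlgebra₂ p) (BigRepModule (IwasawaAlgebra p) p A))
    (w : HeightOneSpectrum (𝓞 K)) :
    Module.Finite (IwasawaAlgebra₂ p)
      (CharacterModule ↥((AnticyclotomicBigGaloisRep κ ρ).restrict (localMap K (Sum.inr w))).toTopRep.ρ.invariants) :=
  Greenberg2006.isCofinitelyGenerated_iff_module_finite_characterModule.mp (hD.submodule _)

/-- **The almost-divisible core `p^a · L_w` at an inertia place `w ∤ p`, modulo (M3).** For `𝒪 = ℤ_p⟦X⟧`, `B = 𝒪⟦T⟧`,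
a `ℤ_p`-extension `κ`, a discrete `ρ : Γ_K → Aut_𝒪(A)` whose big module `𝐃` is cofinitely generated over `B`, and ANY
`B`-linear surjection `π : 𝐃^{I_w} ↠ L_w` onto a submodule `L_w ≤ H` (read: the unramified local condition inside
`H = H¹(K_w, 𝐃)`), SOME `p^a · L_w` is almost divisible. (§2 + (M1) + helper #3
`exists_isAlmostDivisible_map_lsmul_pow_of_surjective_of_mem_iff`.) [cite: Greenberg2016Selmer, §2.5 p. 8 L35–37, Remark 3.1.2, §4.2 p. 19 L25–31]
[cite: Greenberg2006, Prop. 2.4, §3 A] -/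
theorem exists_isAlmostDivisible_map_lsmul_pow_of_inertia (κ : ZpExtension K p)
    (ρ : ContinuousRep (absoluteGaloisGroup K) (IwasawaAlgebra p) A)
    (hD : Greenberg2006.IsCofinitelyGenerated (IwasawaAlgebra₂ p) (BigRepModule (IwasawaAlgebra p) p A))
    {w : HeightOneSpectrum (𝓞 K)} (hw : ((p : ℕ) : 𝓞 K) ∉ w.asIdeal)
    {H : Type} [AddCommGroup H] [Module (IwasawaAlgebra₂ p) H] (N : Submodule (IwasawaAlgebra₂ p) H)
    (π : ↥((AnticyclotomicBigGaloisRep κ ρ).restrict (localMap K (Sum.inr w))).toTopRep.ρ.invariants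
      →ₗ[IwasawaAlgebra₂ p] ↥N)
    (hπ : Function.Surjective π) :
    ∃ a : ℕ, IsAlmostDivisible (IwasawaAlgebra₂ p)
      ↥(N.map (LinearMap.lsmul (IwasawaAlgebra₂ p) H (((p : ℕ) : IwasawaAlgebra₂ p) ^ a))) := by
  haveI := module_finite_characterModule_invariants_restrict p κ ρ hD w
  exact TelescopeK2BigRepTDivisible.exists_isAlmostDivisible_map_lsmul_pow_of_surjective_of_mem_iff p A
    (⨅ h : LocalGroup K (Sum.inr w),
      LinearMap.eqLocus (ρ (localMap K (Sum.inr w) h)) LinearMap.id).toAddSubgroup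
    _ (fun Φ ↦ mem_invariants_restrict_inr_iff κ ρ hw Φ) N π hπ

end Docking

end Summit.BirchSwinnertonDyer.BirchSwinnertonDyer.Theorems.TelescopeK2BigRepInertiaInvariants
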